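import Literature.Analysis.FluidPDE.MVWeakStrongDefs
import Mathlib.Analysis.Calculus.FDeriv.Measurable
import Mathlib.MeasureTheory.Integral.Prod
import HarnessLib

/-!
# BF18 shell for functions (crux `ChaosClosesEuler`, stmt-AtomisticToContinuum-15141, line `Sketch`,
# stub `stub_bf18Shell`) — measurability / integrability kit for the shell field

WHAT. The deterministic Březina–Feireisl relative-energy shell of the line integrates, over the torus
`𝕋³ = UnitAddTorus (Fin 3)` and over time windows, pointwise functions of a MEASURABLE bounded shell field
`V = (ϱ, m, E) : α → ℝ × E³ × ℝ` (`ϱ ≥ 0`) composed with the cold/warm selector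
`θo U = 2/3 (E/ϱ - |m|²/(2ϱ²))`, the clamped entropy `Zs`, the pressure `pV = ϱ θo χe(ϱ)` and the tree's
relative-energy integrands (`StrongPointData.relEnergyZ`, `rawRHS`, `contI`, `momI`, `entI`, `divPU`) for the
monatomic equation of state `EulerEOS.monatomicExcess χe f`, evaluated at point data `d z` whose components are
measurable in `z`. This file records:

* `measurable_comp_nonneg` — for `g` continuous on `(0,∞)` only (arbitrary elsewhere), `z ↦ g (φ z)` is
  measurable for every measurable `φ ≥ 0` (modify `g` off `(0,∞)` to the constant `g 0`);
* `stub_bf18ShellMeas` (registered) — measurability of `Zs ∘ V` and `pV ∘ V`;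
* `measurable_obs` — measurability of `θo ∘ V`, `|m|²`, and the phase map `z ↦ (ϱ, E - |m|²/(2ϱ), m)`;
* `measurable_coeffs` / `measurable_pieces` / `measurable_pieces_sel` — measurability of the derived
  coefficients (`p_ρ, p_ϑ, ∂ₜp, ∇p, μ_ρ, μ_ϑ, ∂ₜφ₁, ∇φ₁, divU, divPU, p, s, μ` of the data) and of the integrands
  `contI, momI, entI, relEnergyZ, rawRHS (+ divPU)` along `z`, for a fixed measurable cut-off `Z` and for the
  cold/warm selector `if 0 < θo then clamp a b else a`;
* `measurable_modify_pieces_sel` — the same for data continuous on a measurable set `S` only (as the point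
  data `pdAt` of a classical solution on `(0,T) × 𝕋³`): the modifications off `S` by `0` are measurable;
* `integrable_of_abs_le`, `isFiniteMeasure_restrict_strip`, `volume_strip`, `measurable_integral_slice`,
  `integrable_integral_slice` — bounded measurable functions on finite measures are
  integrable, the strip `[t₁,t₂] × 𝕋³` has finite measure `t₂ - t₁`, and slice integrals `s ↦ ∫ₓ g(s,x)` of a
  bounded measurable `g` are measurable, bounded by the same constant and integrable on time windows.

WHY. These are the measure-theoretic side conditions of the shell assembly (`stub_bf18Shell`): every Fubini,
every `∫ (f + g) = ∫ f + ∫ g` and every monotonicity-of-the-integral step there needs them.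

No named fact is invoked.
-/

noncomputable section

namespace Summit.AtomisticToContinuum.HydrodynamicLimit.Theorems.ChaosClosesEulerShellMeas

open Set MeasureTheory Literature.Analysis.FluidPDE Literature.Analysis.FluidPDE.CompressibleEuler
  Literature.Analysis.FluidPDE.CompressibleEuler.StrongPointData
  Literature.Analysis.FluidPDE.CompressibleEuler.EulerPhase
  Literature.Analysis.FluidPDE.CompressibleEuler.EulerEOS

/-! ## Composition with a function continuous on `(0,∞)` -/

/-- For `g` continuous on `(0,∞)` (arbitrary elsewhere), `z ↦ g (φ z)` is measurable for every measurable
`φ ≥ 0`: the modification of `g` off `(0,∞)` by the constant `g 0` is Borel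
(`ContinuousOn.measurable_piecewise`) and agrees with `g` on `[0,∞)`. [folklore] -/
theorem measurable_comp_nonneg {g : ℝ → ℝ} (hg : ContinuousOn g (Ioi 0)) {α : Type*} [MeasurableSpace α]
    {φ : α → ℝ} (hφ : Measurable φ) (hφ0 : ∀ z, 0 ≤ φ z) : Measurable fun z => g (φ z) := by
  classical
  have hG : Measurable ((Ioi (0 : ℝ)).piecewise g fun _ => g 0) :=
    hg.measurable_piecewise continuousOn_const measurableSet_Ioi
  have heq : (fun z => g (φ z)) = ((Ioi (0 : ℝ)).piecewise g fun _ => g 0) ∘ φ := by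
    funext z
    simp only [Function.comp_apply, Set.piecewise, mem_Ioi]
    split_ifs with h
    · rfl
    · rw [le_antisymm (not_lt.1 h) (hφ0 z)]
  rw [heq]; exact hG.comp hφ

/-! ## The observables of the shell field -/

/-- Measurability of the cold/warm selector `θo ∘ V`, of `|m|²`, of the internal energy
`E - |m|²/(2ϱ)` and of the phase map `z ↦ (ϱ, E - |m|²/(2ϱ), m) : EulerPhase`. [folklore] -/
theorem measurable_obs {α : Type*} [MeasurableSpace α] {V : α → ℝ × EuclideanSpace ℝ (Fin 3) × ℝ} (hV : Measurable V) :
    Measurable (fun z => 2 / 3 * ((V z).2.2 / (V z).1 - ‖(V z).2.1‖ ^ 2 / (2 * (V z).1 ^ 2))) ∧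
    Measurable (fun z => ‖(V z).2.1‖ ^ 2) ∧
    Measurable (fun z => (V z).2.2 - ‖(V z).2.1‖ ^ 2 / (2 * (V z).1)) ∧
    Measurable (fun z => (((V z).1, (V z).2.2 - ‖(V z).2.1‖ ^ 2 / (2 * (V z).1), (V z).2.1) : EulerPhase)) := by
  have h1 : Measurable fun z => (V z).1 := hV.fst
  have h2 : Measurable fun z => (V z).2.1 := hV.snd.fst
  have h3 : Measurable fun z => (V z).2.2 := hV.snd.snd
  have hn : Measurable fun z => ‖(V z).2.1‖ ^ 2 := h2.norm.pow_const 2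
  have hE : Measurable fun z => (V z).2.2 - ‖(V z).2.1‖ ^ 2 / (2 * (V z).1) := h3.sub (hn.div (measurable_const.mul h1))
  exact ⟨measurable_const.mul ((h3.div h1).sub (hn.div (measurable_const.mul (h1.pow_const 2)))), hn, hE,
    h1.prodMk (hE.prodMk h2)⟩

/-! ## The registered stub: measurability of `Zs ∘ V` and `pV ∘ V` -/

/-- **Registered stub.** For `χe, f` continuous on `(0,∞)` and a measurable shell field `V = (ϱ, m, E)`
with `ϱ ≥ 0`, the clamped entropy `Zs ∘ V` (`a` on cold states `θo ≤ 0`, which include the vacuum) and the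
pressure `pV ∘ V = ϱ θo χe(ϱ)` are measurable (`χe ∘ ϱ`, `f ∘ ϱ` through `measurable_comp_nonneg`).
[folklore] -/
theorem stub_bf18ShellMeas : ∀ (χe f : ℝ → ℝ) (a b : ℝ), ContinuousOn χe (Set.Ioi 0) →
    ContinuousOn f (Set.Ioi 0) → ∀ {α : Type} [MeasurableSpace α] (V : α → ℝ × EuclideanSpace ℝ (Fin 3) × ℝ),
    Measurable V → (∀ z, 0 ≤ (V z).1) →
    Measurable (fun z => if 0 < 2 / 3 * ((V z).2.2 / (V z).1 - ‖(V z).2.1‖ ^ 2 / (2 * (V z).1 ^ 2)) then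
      max a (min (3 / 2 * Real.log (2 / 3 * ((V z).2.2 / (V z).1 - ‖(V z).2.1‖ ^ 2 / (2 * (V z).1 ^ 2))) -
        Real.log (V z).1 - f (V z).1) b) else a) ∧
    Measurable (fun z => (V z).1 * (2 / 3 * ((V z).2.2 / (V z).1 - ‖(V z).2.1‖ ^ 2 / (2 * (V z).1 ^ 2))) *
      χe (V z).1) := by
  intro χe f a b hχ hf α _ V hV hV0
  have h1 : Measurable fun z => (V z).1 := hV.fst
  have hθ := (measurable_obs hV).1
  have hfV : Measurable fun z => f (V z).1 := measurable_comp_nonneg hf h1 hV0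
  have hχV : Measurable fun z => χe (V z).1 := measurable_comp_nonneg hχ h1 hV0
  refine ⟨?_, (h1.mul hθ).mul hχV⟩
  refine Measurable.ite (measurableSet_lt measurable_const hθ) ?_ measurable_const
  exact measurable_const.max ((((measurable_const.mul hθ.log).sub h1.log).sub hfV).min measurable_const)


/-! ## The monatomic equation of state: explicit constitutive functions and coefficients -/

section Monatomic

variable {χe f : ℝ → ℝ}

/-- `p(ρ,ϑ) = ρ ϑ χe(ρ)` for the monatomic law. [folklore] -/
theorem monatomic_p (r Θ : ℝ) : (monatomicExcess χe f).p r Θ = r * Θ * χe r := rfl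

/-- `s(ρ,ϑ) = 3/2 log ϑ - log ρ - f(ρ)` for the monatomic law. [folklore] -/
theorem monatomic_s (r Θ : ℝ) : (monatomicExcess χe f).s r Θ = 3 / 2 * Real.log Θ - Real.log r - f r := rfl

/-- `e(ρ,ϑ) = 3ϑ/2` for the monatomic law. [folklore] -/
theorem monatomic_e (r Θ : ℝ) : (monatomicExcess χe f).e r Θ = 3 / 2 * Θ := rfl

/-- `ϑ(ρ,E) = 2E/(3ρ)` for the monatomic law. [folklore] -/
theorem monatomic_stateTemp (ρ E : ℝ) : stateTemp (monatomicExcess χe f) ρ E = 2 * E / (3 * ρ) := rfl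

/-- `p_ρ(r,Θ) = Θ · (x χe(x))'(r)` — unconditionally (`deriv_const_mul_field`). [folklore] -/
theorem monatomic_pρ (d : StrongPointData) : d.pρ (monatomicExcess χe f) = d.Θ * deriv (fun x => x * χe x) d.r := by
  unfold pρ
  have : (fun x => (monatomicExcess χe f).p x d.Θ) = fun x => d.Θ * (x * χe x) := by
    funext x; simp only [monatomic_p]; ring
  rw [this, deriv_const_mul_field]

/-- `p_ϑ(r,Θ) = r χe(r)`. [folklore] -/
theorem monatomic_pϑ (d : StrongPointData) : d.pϑ (monatomicExcess χe f) = d.r * χe d.r := by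
  unfold pϑ
  have : (fun θ => (monatomicExcess χe f).p d.r θ) = fun θ => d.r * χe d.r * θ := by
    funext θ; simp only [monatomic_p]; ring
  rw [this, deriv_const_mul_field, deriv_id'', mul_one]

end Monatomic

/-! ## Measurability of the coefficients and of the integrands along measurable data -/

section Data

variable {χe f : ℝ → ℝ} {α : Type*} [MeasurableSpace α] {d : α → StrongPointData}
  {V : α → ℝ × EuclideanSpace ℝ (Fin 3) × ℝ}

/-- Coordinates of a measurable `E³`-valued map are measurable. [folklore] -/
theorem measurable_coord {v : α → EuclideanSpace ℝ (Fin 3)} (hv : Measurable v) (i : Fin 3) :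
    Measurable fun z => v z i :=
  (EuclideanSpace.proj i : EuclideanSpace ℝ (Fin 3) →L[ℝ] ℝ).measurable.comp hv

/-- **Measurability of the derived coefficients** of measurable point data with `r ≥ 0`, for the monatomic law
with `χe, f` continuous on `(0,∞)`: `p_ρ, p_ϑ, ∂ₜp, ∂ⱼp, μ_ρ, μ_ϑ, ∂ₜφ₁, ∂ⱼφ₁, divU, div(pU)` and
`p(r,Θ), s(r,Θ), μ(r,Θ)` (`p_ρ = Θ (xχe)'(r)` and `deriv` of any function is measurable, `measurable_deriv`;
`χe ∘ r`, `f ∘ r` through `measurable_comp_nonneg`). [folklore] -/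
theorem measurable_coeffs (hχ : ContinuousOn χe (Ioi 0)) (hf : ContinuousOn f (Ioi 0))
    (hr : Measurable fun z => (d z).r) (hΘ : Measurable fun z => (d z).Θ) (hrt : Measurable fun z => (d z).rt)
    (hΘt : Measurable fun z => (d z).Θt) (hU : Measurable fun z => (d z).U) (hUt : Measurable fun z => (d z).Ut)
    (hgr : Measurable fun z => (d z).gr) (hgΘ : Measurable fun z => (d z).gΘ)
    (hgU : ∀ i j, Measurable fun z => (d z).gU i j) (hr0 : ∀ z, 0 ≤ (d z).r) :
    Measurable (fun z => (d z).pρ (monatomicExcess χe f)) ∧ Measurable (fun z => (d z).pϑ (monatomicExcess χe f)) ∧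
    Measurable (fun z => (d z).pt (monatomicExcess χe f)) ∧ (∀ j, Measurable (fun z => (d z).gp (monatomicExcess χe f) j)) ∧
    Measurable (fun z => (d z).μρ (monatomicExcess χe f)) ∧ Measurable (fun z => (d z).μϑ (monatomicExcess χe f)) ∧
    Measurable (fun z => (d z).φ₁t (monatomicExcess χe f)) ∧ (∀ j, Measurable (fun z => (d z).gφ₁ (monatomicExcess χe f) j)) ∧
    Measurable (fun z => (d z).divU) ∧ Measurable (fun z => divPU (monatomicExcess χe f) (d z)) ∧
    Measurable (fun z => (monatomicExcess χe f).p (d z).r (d z).Θ) ∧ Measurable (fun z => (monatomicExcess χe f).s (d z).r (d z).Θ) ∧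
    Measurable (fun z => (monatomicExcess χe f).chemPotential (d z).r (d z).Θ) := by
  have hχr : Measurable fun z => χe (d z).r := measurable_comp_nonneg hχ hr hr0
  have hfr : Measurable fun z => f (d z).r := measurable_comp_nonneg hf hr hr0
  have hD : Measurable fun z => deriv (fun x => x * χe x) (d z).r := (measurable_deriv _).comp hr
  have hUi := measurable_coord hU; have hUti := measurable_coord hUt
  have hgri := measurable_coord hgr; have hgΘi := measurable_coord hgΘ
  have hpρ : Measurable (fun z => (d z).pρ (monatomicExcess χe f)) := by
    simp_rw [monatomic_pρ]; exact hΘ.mul hD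
  have hpϑ : Measurable (fun z => (d z).pϑ (monatomicExcess χe f)) := by
    simp_rw [monatomic_pϑ]; exact hr.mul hχr
  have hp : Measurable (fun z => (monatomicExcess χe f).p (d z).r (d z).Θ) := by
    simp only [monatomic_p]; exact (hr.mul hΘ).mul hχr
  have hs : Measurable (fun z => (monatomicExcess χe f).s (d z).r (d z).Θ) := by
    simp only [monatomic_s]; exact ((measurable_const.mul hΘ.log).sub hr.log).sub hfr
  have hμρ : Measurable (fun z => (d z).μρ (monatomicExcess χe f)) := by
    unfold μρ; exact hpρ.div hr
  have hμϑ : Measurable (fun z => (d z).μϑ (monatomicExcess χe f)) := by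
    unfold μϑ; exact hs.neg.add (hpϑ.div hr)
  have hpt : Measurable (fun z => (d z).pt (monatomicExcess χe f)) := by
    unfold pt; exact (hpρ.mul hrt).add (hpϑ.mul hΘt)
  have hgp : ∀ j, Measurable (fun z => (d z).gp (monatomicExcess χe f) j) := fun j => by
    unfold gp; exact (hpρ.mul (hgri j)).add (hpϑ.mul (hgΘi j))
  have hφ₁t : Measurable (fun z => (d z).φ₁t (monatomicExcess χe f)) := by
    unfold φ₁t
    exact (Finset.measurable_sum _ fun i _ => (hUi i).mul (hUti i)).sub ((hμρ.mul hrt).add (hμϑ.mul hΘt))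
  have hgφ₁ : ∀ j, Measurable (fun z => (d z).gφ₁ (monatomicExcess χe f) j) := fun j => by
    unfold gφ₁
    exact (Finset.measurable_sum _ fun i _ => (hUi i).mul (hgU i j)).sub ((hμρ.mul (hgri j)).add (hμϑ.mul (hgΘi j)))
  have hdivU : Measurable (fun z => (d z).divU) := by
    unfold divU; exact Finset.measurable_sum _ fun i _ => hgU i i
  have hμ : Measurable (fun z => (monatomicExcess χe f).chemPotential (d z).r (d z).Θ) := by
    unfold chemPotential; simp only [monatomic_e]
    exact ((measurable_const.mul hΘ).sub (hΘ.mul hs)).add (hp.div hr)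
  have hdivPU : Measurable (fun z => divPU (monatomicExcess χe f) (d z)) := by
    unfold divPU; exact (hp.mul hdivU).add (Finset.measurable_sum _ fun j _ => (hUi j).mul (hgp j))
  exact ⟨hpρ, hpϑ, hpt, hgp, hμρ, hμϑ, hφ₁t, hgφ₁, hdivU, hdivPU, hp, hs, hμ⟩

/-- **Measurability of the integrands** `contI`, `momI`, `entI Z`, `relEnergyZ Z`, `rawRHS Z` along `z`, at the
state `w = (ϱ, E - |m|²/(2ϱ), m)` of a measurable shell field `V = (ϱ, m, E)` with `ϱ ≥ 0`, for a fixed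
measurable cut-off `Z` and measurable data with `r ≥ 0` (explicit formulas; `rawRHS` through `rawRHS_eq_pieces`).
[folklore] -/
theorem measurable_pieces (hχ : ContinuousOn χe (Ioi 0)) (hf : ContinuousOn f (Ioi 0))
    (hV : Measurable V) (hV0 : ∀ z, 0 ≤ (V z).1)
    (hr : Measurable fun z => (d z).r) (hΘ : Measurable fun z => (d z).Θ) (hrt : Measurable fun z => (d z).rt)
    (hΘt : Measurable fun z => (d z).Θt) (hU : Measurable fun z => (d z).U) (hUt : Measurable fun z => (d z).Ut)
    (hgr : Measurable fun z => (d z).gr) (hgΘ : Measurable fun z => (d z).gΘ)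
    (hgU : ∀ i j, Measurable fun z => (d z).gU i j) (hr0 : ∀ z, 0 ≤ (d z).r)
    {Z : ℝ → ℝ} (hZ : Measurable Z) :
    Measurable (fun z => (d z).contI (monatomicExcess χe f) ((V z).1, (V z).2.2 - ‖(V z).2.1‖ ^ 2 / (2 * (V z).1), (V z).2.1)) ∧
    Measurable (fun z => (d z).momI (monatomicExcess χe f) ((V z).1, (V z).2.2 - ‖(V z).2.1‖ ^ 2 / (2 * (V z).1), (V z).2.1)) ∧
    Measurable (fun z => (d z).entI (monatomicExcess χe f) Z ((V z).1, (V z).2.2 - ‖(V z).2.1‖ ^ 2 / (2 * (V z).1), (V z).2.1)) ∧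
    Measurable (fun z =>
      (d z).relEnergyZ (monatomicExcess χe f) Z ((V z).1, (V z).2.2 - ‖(V z).2.1‖ ^ 2 / (2 * (V z).1), (V z).2.1)) ∧
    Measurable (fun z =>
      rawRHS (monatomicExcess χe f) Z (d z) (V z).1 ((V z).2.2 - ‖(V z).2.1‖ ^ 2 / (2 * (V z).1)) (V z).2.1) := by
  obtain ⟨-, -, hpt, -, -, -, hφ₁t, hgφ₁, hdivU, -, hp, -, hμ⟩ := measurable_coeffs hχ hf hr hΘ hrt hΘt hU hUt hgr hgΘ hgU hr0
  obtain ⟨-, -, hE, -⟩ := measurable_obs hV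
  have h1 : Measurable fun z => (V z).1 := hV.fst
  have hm : Measurable fun z => (V z).2.1 := hV.snd.fst
  have hmi := measurable_coord hm; have hUi := measurable_coord hU
  have hUti := measurable_coord hUt; have hgΘi := measurable_coord hgΘ
  have hfV : Measurable fun z => f (V z).1 := measurable_comp_nonneg hf h1 hV0
  have hχV : Measurable fun z => χe (V z).1 := measurable_comp_nonneg hχ h1 hV0
  set E' : α → ℝ := fun z => (V z).2.2 - ‖(V z).2.1‖ ^ 2 / (2 * (V z).1) with hE'
  -- thermodynamic functions of the state
  have hT : Measurable fun z => stateTemp (monatomicExcess χe f) (V z).1 (E' z) := by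
    simp only [monatomic_stateTemp]; exact (measurable_const.mul hE).div (measurable_const.mul h1)
  have hsw : Measurable fun z => (monatomicExcess χe f).s (V z).1 (stateTemp (monatomicExcess χe f) (V z).1 (E' z)) := by
    simp only [monatomic_s]; exact ((measurable_const.mul hT.log).sub h1.log).sub hfV
  have hpw : Measurable fun z => (monatomicExcess χe f).p (V z).1 (stateTemp (monatomicExcess χe f) (V z).1 (E' z)) := by
    simp only [monatomic_p]; exact (h1.mul hT).mul hχV
  have hZs : Measurable fun z => Z ((monatomicExcess χe f).s (V z).1 (stateTemp (monatomicExcess χe f) (V z).1 (E' z))) :=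
    hZ.comp hsw
  have hkin : Measurable fun z => kineticEnergy (((V z).1, E' z, (V z).2.1) : EulerPhase) := by
    simp only [kineticEnergy, mom_mk, dens_mk]; exact (hm.norm.pow_const 2).div (measurable_const.mul h1)
  -- the integrands
  have hcont : Measurable (fun z => (d z).contI (monatomicExcess χe f) ((V z).1, E' z, (V z).2.1)) := by
    simp only [contI, dens_mk, mom_mk]
    exact (h1.mul hφ₁t).add (Finset.measurable_sum _ fun i _ => (hmi i).mul (hgφ₁ i))
  have hmom : Measurable (fun z => (d z).momI (monatomicExcess χe f) ((V z).1, E' z, (V z).2.1)) := by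
    simp only [momI, dens_mk, mom_mk, ien_mk]
    exact ((Finset.measurable_sum _ fun i _ => (hmi i).mul (hUti i)).add (Finset.measurable_sum _ fun i _ =>
      Finset.measurable_sum _ fun j _ => (((hmi i).mul (hmi j)).div h1).mul (hgU i j))).add (hpw.mul hdivU)
  have hent : Measurable (fun z => (d z).entI (monatomicExcess χe f) Z ((V z).1, E' z, (V z).2.1)) := by
    simp only [entI, dens_mk, mom_mk, ien_mk]
    exact ((h1.mul hZs).mul hΘt).add (Finset.measurable_sum _ fun i _ => (hZs.mul (hmi i)).mul (hgΘi i))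
  have hrel : Measurable (fun z => (d z).relEnergyZ (monatomicExcess χe f) Z ((V z).1, E' z, (V z).2.1)) := by
    simp only [relEnergyZ, dens_mk, mom_mk, ien_mk]
    exact ((((hkin.add hE).sub (Finset.measurable_sum _ fun i _ => (hmi i).mul (hUi i))).add
      (h1.mul (((hU.norm.pow_const 2).div_const 2).sub hμ))).sub (hΘ.mul (h1.mul hZs))).add hp
  have hraw : Measurable (fun z => rawRHS (monatomicExcess χe f) Z (d z) (V z).1 (E' z) (V z).2.1) := by
    have : (fun z => rawRHS (monatomicExcess χe f) Z (d z) (V z).1 (E' z) (V z).2.1) = fun z =>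
        -(d z).momI (monatomicExcess χe f) ((V z).1, E' z, (V z).2.1) + (d z).contI (monatomicExcess χe f) ((V z).1, E' z, (V z).2.1) -
          (d z).entI (monatomicExcess χe f) Z ((V z).1, E' z, (V z).2.1) + (d z).pt (monatomicExcess χe f) := by
      funext z; exact rawRHS_eq_pieces Z (d z) ((V z).1, E' z, (V z).2.1)
    rw [this]; exact ((hmom.neg.add hcont).sub hent).add hpt
  exact ⟨hcont, hmom, hent, hrel, hraw⟩

/-- Substituting a two-valued selector `if p z then Z₁ else Z₂` into a slot of a `z`-dependent functional
preserves measurability when both branches are measurable and `{p}` is a measurable set. [folklore] -/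
theorem measurable_apply_ite {p : α → Prop} [DecidablePred p] (hp : MeasurableSet {z | p z}) {β : Type*}
    {Z₁ Z₂ : β} (F : α → β → ℝ) (h₁ : Measurable fun z => F z Z₁) (h₂ : Measurable fun z => F z Z₂) :
    Measurable fun z => F z (if p z then Z₁ else Z₂) := by
  have : (fun z => F z (if p z then Z₁ else Z₂)) = fun z => if p z then F z Z₁ else F z Z₂ := by
    funext z; split_ifs <;> rfl
  rw [this]
  exact Measurable.ite hp h₁ h₂

/-- **Selector version.** Along `z`, with the cold/warm selector (`clamp a b` on warm states `θo > 0`, the constant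
`a` on cold ones) as cut-off, `relEnergyZ`, `rawRHS + div(pU)` and `entI` are measurable (split along the
measurable set `{θo > 0}`, `measurable_apply_ite`). [folklore] -/
theorem measurable_pieces_sel (hχ : ContinuousOn χe (Ioi 0)) (hf : ContinuousOn f (Ioi 0))
    (hV : Measurable V) (hV0 : ∀ z, 0 ≤ (V z).1)
    (hr : Measurable fun z => (d z).r) (hΘ : Measurable fun z => (d z).Θ) (hrt : Measurable fun z => (d z).rt)
    (hΘt : Measurable fun z => (d z).Θt) (hU : Measurable fun z => (d z).U) (hUt : Measurable fun z => (d z).Ut)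
    (hgr : Measurable fun z => (d z).gr) (hgΘ : Measurable fun z => (d z).gΘ)
    (hgU : ∀ i j, Measurable fun z => (d z).gU i j) (hr0 : ∀ z, 0 ≤ (d z).r) (a b : ℝ) :
    Measurable (fun z => (d z).relEnergyZ (monatomicExcess χe f)
      (if 0 < 2 / 3 * ((V z).2.2 / (V z).1 - ‖(V z).2.1‖ ^ 2 / (2 * (V z).1 ^ 2)) then clamp a b else fun _ => a)
      ((V z).1, (V z).2.2 - ‖(V z).2.1‖ ^ 2 / (2 * (V z).1), (V z).2.1)) ∧
    Measurable (fun z => rawRHS (monatomicExcess χe f)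
      (if 0 < 2 / 3 * ((V z).2.2 / (V z).1 - ‖(V z).2.1‖ ^ 2 / (2 * (V z).1 ^ 2)) then clamp a b else fun _ => a)
      (d z) (V z).1 ((V z).2.2 - ‖(V z).2.1‖ ^ 2 / (2 * (V z).1)) (V z).2.1 + divPU (monatomicExcess χe f) (d z)) ∧
    Measurable (fun z => (d z).entI (monatomicExcess χe f)
      (if 0 < 2 / 3 * ((V z).2.2 / (V z).1 - ‖(V z).2.1‖ ^ 2 / (2 * (V z).1 ^ 2)) then clamp a b else fun _ => a)
      ((V z).1, (V z).2.2 - ‖(V z).2.1‖ ^ 2 / (2 * (V z).1), (V z).2.1)) := by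
  have hA : MeasurableSet {z | 0 < 2 / 3 * ((V z).2.2 / (V z).1 - ‖(V z).2.1‖ ^ 2 / (2 * (V z).1 ^ 2))} :=
    measurableSet_lt measurable_const (measurable_obs hV).1
  obtain ⟨-, -, -, -, -, -, -, -, -, hdivPU, -⟩ := measurable_coeffs (χe := χe) (f := f) hχ hf hr hΘ hrt hΘt hU hUt hgr hgΘ hgU hr0
  obtain ⟨-, -, he1, hr1, hw1⟩ :=
    measurable_pieces hχ hf hV hV0 hr hΘ hrt hΘt hU hUt hgr hgΘ hgU hr0 (continuous_clamp a b).measurable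
  obtain ⟨-, -, he2, hr2, hw2⟩ :=
    measurable_pieces hχ hf hV hV0 hr hΘ hrt hΘt hU hUt hgr hgΘ hgU hr0 (measurable_const : Measurable fun _ : ℝ => a)
  exact ⟨measurable_apply_ite hA (fun z (Z : ℝ → ℝ) => (d z).relEnergyZ (monatomicExcess χe f) Z
      ((V z).1, (V z).2.2 - ‖(V z).2.1‖ ^ 2 / (2 * (V z).1), (V z).2.1)) hr1 hr2,
    measurable_apply_ite hA (fun z (Z : ℝ → ℝ) => rawRHS (monatomicExcess χe f) Z (d z) (V z).1
      ((V z).2.2 - ‖(V z).2.1‖ ^ 2 / (2 * (V z).1)) (V z).2.1 + divPU (monatomicExcess χe f) (d z)) (hw1.add hdivPU) (hw2.add hdivPU),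
    measurable_apply_ite hA (fun z (Z : ℝ → ℝ) => (d z).entI (monatomicExcess χe f) Z
      ((V z).1, (V z).2.2 - ‖(V z).2.1‖ ^ 2 / (2 * (V z).1), (V z).2.1)) he1 he2⟩

/-- A function whose restriction to a measurable set `S` is measurable has a measurable modification off `S`
by `0` (`measurable_of_restrict_of_restrict_compl`). [folklore] -/
theorem measurable_piecewise_of_restrict {X : Type*} [MeasurableSpace X] {S : Set X} [∀ x, Decidable (x ∈ S)]
    (hS : MeasurableSet S) {F : X → ℝ} (hF : Measurable (S.restrict F)) : Measurable (S.piecewise F 0) :=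
  measurable_of_restrict_of_restrict_compl hS (by rw [restrict_piecewise]; exact hF)
    (by rw [restrict_piecewise_compl]; exact measurable_const)

/-- **Adapter for data continuous on a measurable set only** (the point data `pdAt` of a classical solution are
continuous on `(0,T) × 𝕋³`, `IsClassicalEulerSolution.continuousOn_pointData_base`): with the selector cut-off,
the modifications off `S` by `0` of `relEnergyZ` and of `rawRHS + div(pU)` along `z` are measurable (apply
`measurable_pieces_sel` on the subtype `S`, then `measurable_piecewise_of_restrict`). [folklore] -/
theorem measurable_modify_pieces_sel {X : Type*} [TopologicalSpace X] [MeasurableSpace X] [OpensMeasurableSpace X]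
    {S : Set X} [∀ x, Decidable (x ∈ S)] (hS : MeasurableSet S) (hχ : ContinuousOn χe (Ioi 0)) (hf : ContinuousOn f (Ioi 0))
    {V : X → ℝ × EuclideanSpace ℝ (Fin 3) × ℝ} (hV : Measurable V) (hV0 : ∀ z, 0 ≤ (V z).1) {d : X → StrongPointData}
    (hr : ContinuousOn (fun z => (d z).r) S) (hΘ : ContinuousOn (fun z => (d z).Θ) S) (hrt : ContinuousOn (fun z => (d z).rt) S)
    (hΘt : ContinuousOn (fun z => (d z).Θt) S) (hU : ContinuousOn (fun z => (d z).U) S) (hUt : ContinuousOn (fun z => (d z).Ut) S)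
    (hgr : ContinuousOn (fun z => (d z).gr) S) (hgΘ : ContinuousOn (fun z => (d z).gΘ) S)
    (hgU : ∀ i j, ContinuousOn (fun z => (d z).gU i j) S) (hr0 : ∀ z ∈ S, 0 ≤ (d z).r) (a b : ℝ) :
    Measurable (S.piecewise (fun z => (d z).relEnergyZ (monatomicExcess χe f)
      (if 0 < 2 / 3 * ((V z).2.2 / (V z).1 - ‖(V z).2.1‖ ^ 2 / (2 * (V z).1 ^ 2)) then clamp a b else fun _ => a)
      ((V z).1, (V z).2.2 - ‖(V z).2.1‖ ^ 2 / (2 * (V z).1), (V z).2.1)) 0) ∧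
    Measurable (S.piecewise (fun z => rawRHS (monatomicExcess χe f)
      (if 0 < 2 / 3 * ((V z).2.2 / (V z).1 - ‖(V z).2.1‖ ^ 2 / (2 * (V z).1 ^ 2)) then clamp a b else fun _ => a)
      (d z) (V z).1 ((V z).2.2 - ‖(V z).2.1‖ ^ 2 / (2 * (V z).1)) (V z).2.1 + divPU (monatomicExcess χe f) (d z)) 0) := by
  have key := measurable_pieces_sel (α := S) (d := fun z => d z) (V := fun z => V z) hχ hf
    (hV.comp measurable_subtype_coe) (fun z => hV0 z) hr.restrict.measurable hΘ.restrict.measurable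
    hrt.restrict.measurable hΘt.restrict.measurable hU.restrict.measurable hUt.restrict.measurable
    hgr.restrict.measurable hgΘ.restrict.measurable (fun i j => (hgU i j).restrict.measurable)
    (fun z => hr0 z z.2) a b
  exact ⟨measurable_piecewise_of_restrict hS key.1, measurable_piecewise_of_restrict hS key.2.1⟩

end Data

/-! ## Integrability wrappers -/

section Integrals

/-- On a finite measure, a measurable real function bounded in absolute value is integrable. [folklore] -/
theorem integrable_of_abs_le {α : Type*} [MeasurableSpace α] {μ : Measure α} [IsFiniteMeasure μ]
    {g : α → ℝ} (hg : Measurable g) {C : ℝ} (hC : ∀ z, |g z| ≤ C) : Integrable g μ :=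
  Integrable.of_bound hg.aestronglyMeasurable C (Filter.Eventually.of_forall fun z => by rw [Real.norm_eq_abs]; exact hC z)

/-- The strip `[t₁,t₂] × 𝕋³` has finite space–time measure. [folklore] -/
theorem isFiniteMeasure_restrict_strip (t₁ t₂ : ℝ) :
    IsFiniteMeasure ((volume : Measure (ℝ × UnitAddTorus (Fin 3))).restrict (Icc t₁ t₂ ×ˢ univ)) := by
  refine ⟨?_⟩
  rw [Measure.restrict_apply_univ, Measure.volume_eq_prod, Measure.prod_prod]
  exact ENNReal.mul_lt_top measure_Icc_lt_top (measure_lt_top _ _)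

/-- The space–time measure of the strip `[t₁,t₂] × 𝕋³` is `t₂ - t₁` (the torus has volume one). [folklore] -/
theorem volume_strip (t₁ t₂ : ℝ) :
    (volume : Measure (ℝ × UnitAddTorus (Fin 3))) (Icc t₁ t₂ ×ˢ univ) = ENNReal.ofReal (t₂ - t₁) := by
  rw [Measure.volume_eq_prod, Measure.prod_prod, Real.volume_Icc, measure_univ, mul_one]

/-- A bounded measurable function on the strip `[t₁,t₂] × 𝕋³` is integrable there. [folklore] -/
theorem integrable_strip_of_abs_le {g : ℝ × UnitAddTorus (Fin 3) → ℝ} (hg : Measurable g) {C : ℝ}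
    (hC : ∀ z, |g z| ≤ C) (t₁ t₂ : ℝ) :
    Integrable g ((volume : Measure (ℝ × UnitAddTorus (Fin 3))).restrict (Icc t₁ t₂ ×ˢ univ)) :=
  haveI := isFiniteMeasure_restrict_strip t₁ t₂
  integrable_of_abs_le hg hC

/-- Slice integrals `s ↦ ∫ₓ g(s,x) dx` of a measurable `g` on `ℝ × 𝕋³` are measurable
(`StronglyMeasurable.integral_prod_right'`). [folklore] -/
theorem measurable_integral_slice {g : ℝ × UnitAddTorus (Fin 3) → ℝ} (hg : Measurable g) :
    Measurable fun s => ∫ x, g (s, x) :=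
  hg.stronglyMeasurable.integral_prod_right'.measurable

/-- The slice integrals of a bounded measurable `g` on `ℝ × 𝕋³` are bounded by the same constant (the torus has
volume one; `norm_integral_le_of_norm_le_const`, cf. the landed `BDSV.abs_integral_le_of_abs_le`) and integrable
on every time window `[t₁,t₂]`. [folklore] -/
theorem integrable_integral_slice {g : ℝ × UnitAddTorus (Fin 3) → ℝ} (hg : Measurable g) {C : ℝ}
    (hC : ∀ z, |g z| ≤ C) (t₁ t₂ : ℝ) :
    (∀ s, |∫ x, g (s, x)| ≤ C) ∧ Integrable (fun s => ∫ x, g (s, x)) ((volume : Measure ℝ).restrict (Icc t₁ t₂)) := by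
  have hb : ∀ s, |∫ x, g (s, x)| ≤ C := fun s => by
    have h := norm_integral_le_of_norm_le_const (μ := (volume : Measure (UnitAddTorus (Fin 3)))) (f := fun x => g (s, x))
      (C := C) (Filter.Eventually.of_forall fun x => by rw [Real.norm_eq_abs]; exact hC (s, x))
    rwa [probReal_univ, mul_one, Real.norm_eq_abs] at h
  haveI : IsFiniteMeasure ((volume : Measure ℝ).restrict (Icc t₁ t₂)) := isFiniteMeasure_restrict.2 measure_Icc_lt_top.ne
  exact ⟨hb, integrable_of_abs_le (measurable_integral_slice hg) hb⟩

end Integrals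

end Summit.AtomisticToContinuum.HydrodynamicLimit.Theorems.ChaosClosesEulerShellMeas

end
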